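import Summits.BirchSwinnertonDyer.BirchSwinnertonDyer.Theorems.GenusKolyvaginAtTwoCasselsTatePTcRealReadout
import Literature.NumberTheory.EllipticCurves.CasselsTateAlternating
import HarnessLib

/-!
# Route `CMKolyvaginAtInertTwo`, crux `CMKolyvaginExactAtInertTwo` (stmt-BirchSwinnertonDyer-24277):
# the NONDEGENERACY of the canonical level-`2^L` Cassels–Tate pairing on `Ш(E/K)[2^L]` when `Ш[2^{2L}] ⊆ Ш[2^L]`
# — every number field (so `ℚ`), every elliptic curve, `p = 2`

Seat `bsd-line-cmk2-p1` g17 (cell `bsd-print-cf2`); helper (`--supports stmt-BirchSwinnertonDyer-24277`).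
THEOREMS ONLY: no definition, no named fact, no `sorry`; no item is closed; BSD is not proved by this.

KERNEL-STATUS-p2-port.md §17.8 RETRACTED as a gap: gk2-p2's `CasselsTatePTcReal.isLevelPairing_ctLevelPairing_canonical_of_alt`
(`…CasselsTatePTcRealReadout`, EVERY number field incl. the real place of `ℚ`, every prime power) + Cassels' theorem
`ctGeneralFun_self_eq_zero` (alternation at EVERY level, `CasselsTateAlternating`) make the canonical pairing on `Ш[2^L]` a LEVEL
pairing over `ℚ` at `2`: alternating, with kernel `Ш[2^L] ∩ 2^L·Ш`. If moreover every class of `Ш` killed by `2^{2L}` is killed by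
`2^L` (`hkill`: finiteness of `Ш[2^∞]` with `L ≥ v₂ #Ш[2^∞]`, the displayed input of the T2 assembly's member formulas), the kernel
vanishes. These are the inputs `hB₁nd`, `hCT₂nd` of `KolyvaginPairDataTwo.card_mul_card_le_two_pow_two_mul_of_pairData_cmInert`.

* `isLevelPairing_ctLevelPairing_canonical_two_pow` — the canonical pairing on `Ш[2^L]` is a level pairing, unconditionally;
* `nondegenerate_of_isLevelPairing_of_kill` — pure: a level pairing at `2^L` is nondegenerate once `Ш[2^{2L}] ⊆ Ш[2^L]`;
* `ctLevelPairing_canonical_nondegenerate_of_kill` — the composition (`hB₁nd`/`hCT₂nd` from `hkill`).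

References: [MilneADT2006] I §6 Prop. 6.9, Thm. 6.13 (a), Lemma 6.15, Thm. 4.10; [Cassels1962ArithmeticIV] §1.
-/

-- single-conjunct summit: `Summit.BirchSwinnertonDyer.BirchSwinnertonDyer.…` repeats the name by design
set_option linter.dupNamespace false
set_option autoImplicit false

noncomputable section

open scoped Classical
open scoped AddSubgroup

namespace Summit.BirchSwinnertonDyer.BirchSwinnertonDyer.Theorems.KolyvaginPairDataTwo

open WeierstrassCurve NumberField Field
open Literature.NumberTheory.EllipticCurves Literature.NumberTheory.GaloisRepresentations
open Literature.NumberTheory.GaloisCohomology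
open Literature.GroupTheory.FiniteAbelian (IsLevelPairing)
open Summit.BirchSwinnertonDyer.BirchSwinnertonDyer.Theorems.GenusExact
open Summit.BirchSwinnertonDyer.BirchSwinnertonDyer.Theorems.GenusExact.VisiblePairAtTwo (shaThree_mu_eq_zero)

variable {K : Type} [Field K] [NumberField K] (W : WeierstrassCurve K) [W.IsElliptic] {L : ℕ}
  (e : geomTorsion W ((2 ^ L * 2 ^ L : ℕ) : ℤ) → geomTorsion W ((2 ^ L * 2 ^ L : ℕ) : ℤ) → AlgebraicClosure K)
  (hμ : ∀ S T, e S T ^ (2 ^ L * 2 ^ L) = 1)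
  (hadd₁ : ∀ S₁ S₂ T, e (S₁ + S₂) T = e S₁ T * e S₂ T)
  (hadd₂ : ∀ S T₁ T₂, e S (T₁ + T₂) = e S T₁ * e S T₂)
  (hgal : ∀ (σ : absoluteGaloisGroup K) (S T : geomTorsion W ((2 ^ L * 2 ^ L : ℕ) : ℤ)), σ • e S T = e (σ • S) (σ • T))
  (halt : ∀ T, e T T = 1) (hnd : ∀ T, (∀ S, e S T = 1) → T = 0)

include hnd in
/-- **The canonical Cassels–Tate pairing on `Ш(E/K)[2^L]` is a LEVEL pairing** (alternating; kernel `Ш[2^L] ∩ 2^L·Ш`), for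
every number field `K`, every elliptic curve, every `L ≥ 1` — gk2-p2's `isLevelPairing_ctLevelPairing_canonical_of_alt` with
Cassels' alternation `ctGeneralFun_self_eq_zero` supplied. [cite: MilneADT2006, Ch. I §6 Thm. 6.13 (a)] [cite: Cassels1962ArithmeticIV, §1] -/
theorem isLevelPairing_ctLevelPairing_canonical_two_pow [NeZero (2 ^ L)] [NeZero (2 ^ L * 2 ^ L)] (hL : 0 < L) :
    IsLevelPairing (2 ^ L)
      (ctLevelPairing W (2 ^ L) e hμ hadd₁ hadd₂ hgal (LocalInvariants.canonical K (2 ^ L * 2 ^ L)) halt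
        (sumInvLocalizationEqZero_canonical_of_numberField K (2 ^ L * 2 ^ L)) (shaThree_mu_eq_zero K (2 ^ L * 2 ^ L))
        (localTerm_finite_support W (2 ^ L) e hμ hadd₁ hadd₂ hgal halt (LocalInvariants.canonical K (2 ^ L * 2 ^ L)))) := by
  haveI : Fact (Nat.Prime 2) := ⟨Nat.prime_two⟩
  exact CasselsTatePTcReal.isLevelPairing_ctLevelPairing_canonical_of_alt W 2 L e hμ hadd₁ hadd₂ hgal halt hnd hL
    fun a ha hma ↦ ctGeneralFun_self_eq_zero halt _ (sumInvLocalizationEqZero_canonical_of_numberField K (2 ^ L * 2 ^ L))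
      (shaThree_mu_eq_zero K (2 ^ L * 2 ^ L)) ha hma

omit [W.IsElliptic] in
/-- **A level pairing at `2^L` is nondegenerate when `Ш[2^{2L}] ⊆ Ш[2^L]`** (pure): a class in the kernel is `2^L z` with
`z ∈ Ш`, `2^{2L} z = 0`, hence `2^L z = 0`. [cite: MilneADT2006, Ch. I §6 Thm. 6.13 (a)] -/
theorem nondegenerate_of_isLevelPairing_of_kill {T : Type*} [AddCommGroup T]
    (B : (W.sha)[(2 ^ L : ℕ)] →+ (W.sha)[(2 ^ L : ℕ)] →+ T) (hB : IsLevelPairing (2 ^ L) B)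
    (hkill : ∀ a ∈ W.sha, ((2 : ℤ) ^ (2 * L)) • a = 0 → ((2 : ℤ) ^ L) • a = 0) :
    ∀ a : (W.sha)[(2 ^ L : ℕ)], (∀ b, B a b = 0) → a = 0 := by
  intro a ha
  obtain ⟨z, hz⟩ := (hB.2 a).mp ha
  -- `2^L • (a : Ш) = 0`
  have ha0 : (2 ^ L) • ((a : W.sha)) = 0 := by
    rw [← AddSubgroupClass.coe_nsmul, AddSubgroup.torsionBy.nsmul, ZeroMemClass.coe_zero]
  -- `2^{2L} • z = 0` in `Ш`, read in `H¹(K, E)`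
  have hz2 : ((2 : ℤ) ^ (2 * L)) • (z : W.galH1) = 0 := by
    have h1 : (2 ^ L * 2 ^ L) • z = 0 := by rw [mul_comm, mul_nsmul, hz, ha0]
    have h2 := congrArg (fun x : W.sha ↦ (x : W.galH1)) h1
    simp only [AddSubgroupClass.coe_nsmul, ZeroMemClass.coe_zero] at h2
    rw [← natCast_zsmul] at h2
    rw [two_mul, pow_add]
    exact_mod_cast h2
  have hzL : ((2 : ℤ) ^ L) • (z : W.galH1) = 0 := hkill _ z.2 hz2
  have hzL' : (2 ^ L) • z = 0 := by
    apply Subtype.ext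
    rw [AddSubgroupClass.coe_nsmul, ZeroMemClass.coe_zero, ← natCast_zsmul]
    exact_mod_cast hzL
  apply Subtype.ext
  rw [← hz, hzL', ZeroMemClass.coe_zero]

include hnd in
/-- **`hB₁nd` / `hCT₂nd` of the T2 assembly from `hkill`**: the canonical Cassels–Tate pairing on `Ш(E/K)[2^L]` is nondegenerate
as soon as `Ш[2^{2L}] ⊆ Ш[2^L]` (`L ≥ 1`; every number field, every curve). [cite: MilneADT2006, Ch. I §6 Thm. 6.13 (a)]
[cite: Cassels1962ArithmeticIV, §1] -/
theorem ctLevelPairing_canonical_nondegenerate_of_kill [NeZero (2 ^ L)] [NeZero (2 ^ L * 2 ^ L)] (hL : 0 < L)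
    (hkill : ∀ a ∈ W.sha, ((2 : ℤ) ^ (2 * L)) • a = 0 → ((2 : ℤ) ^ L) • a = 0) :
    ∀ a : (W.sha)[(2 ^ L : ℕ)], (∀ b,
      ctLevelPairing W (2 ^ L) e hμ hadd₁ hadd₂ hgal (LocalInvariants.canonical K (2 ^ L * 2 ^ L)) halt
        (sumInvLocalizationEqZero_canonical_of_numberField K (2 ^ L * 2 ^ L)) (shaThree_mu_eq_zero K (2 ^ L * 2 ^ L))
        (localTerm_finite_support W (2 ^ L) e hμ hadd₁ hadd₂ hgal halt (LocalInvariants.canonical K (2 ^ L * 2 ^ L)))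
        a b = 0) → a = 0 :=
  nondegenerate_of_isLevelPairing_of_kill W _
    (isLevelPairing_ctLevelPairing_canonical_two_pow W e hμ hadd₁ hadd₂ hgal halt hnd hL) hkill

end Summit.BirchSwinnertonDyer.BirchSwinnertonDyer.Theorems.KolyvaginPairDataTwo

end
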